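import Summits.CriticalPhenomena.PercolationContinuityZ3.Theorems.PercNearOneGluingNoHeavyLowerTailSahiCoordinateAntitone
import Mathlib.Topology.Order.OrderClosed
import Mathlib.Topology.Algebra.Polynomial
import Mathlib.Tactic.Linarith
import Mathlib.Tactic.Ring
import HarnessLib

/-!
# `NoHeavyLowerTail` (crux stmt-CriticalPhenomena-4575), master-family line P2: the converse — (MT-3) gives back the two-thirds inequality at every coordinate
# (for strictly positive parameters)

Support file (seat `prim-masterthm-p2`, gen 12; `--supports stmt-CriticalPhenomena-4575`); no new definition, no sorry.  Memo SAHI-ROUTE.md §4.35(a),(d).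

p289656 proved `TwoThirds → MasterAntitone 3`.  Here: `MasterAntitone 3` ⟹ (T3) at every coordinate `e` of every increasing triple, for every parameter vector with
strictly positive entries (`twoThirdsAt_of_masterAntitone_three`).  Proof: comparing `p[e↦x]` with `p[e↦1]` and cancelling `∏_{i≠e} p_i > 0` gives `x·E(1) ≤ E(x)` for the
fibre cubic, i.e. `0 ≤ E⁰ + x(1−x)b₁ + x²b₂` for `x < 1`; let `x → 1⁻`.  (At parameters with a zero entry (T3) is the same statement for a section triple on fewer
coordinates; we do not formalise that transport.)  So (MT-3) and (T3∀) are equivalent up to this boundary bookkeeping.  Axioms standard. [this work]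
-/

noncomputable section

open scoped Classical Topology

namespace Summit.CriticalPhenomena.PercolationContinuityZ3.Theorems

namespace SahiCoordinateAntitone

open Finset Function Filter
open Literature.Combinatorics.Sahi2008
open Literature.Probability.Percolation.DecisionTree (ind ind_of_mem ind_of_not_mem ind_nonneg)
open SahiCoordinateBernstein (coordPiece₁ coordPiece₂ sahiE_three_decomp_coord)
open SahiCoordinateTwoThirds (ind_secAt_vec3)

variable {ι : Type} [Fintype ι]

/-- A real polynomial expression nonnegative on `[1/2, 1)` is nonnegative at `1` (limit from the left). [folklore] -/
theorem nonneg_at_one_of_nonneg_left {E0 b1 b2 : ℝ} (h : ∀ x : ℝ, 1 / 2 < x → x < 1 → 0 ≤ E0 + x * (1 - x) * b1 + x ^ 2 * b2) :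
    0 ≤ E0 + b2 := by
  let φ : ℝ → ℝ := fun x => E0 + x * (1 - x) * b1 + x ^ 2 * b2
  have hcont : Continuous φ := by
    unfold φ
    fun_prop
  have ht : Tendsto φ (𝓝[<] (1 : ℝ)) (𝓝 (φ 1)) := (hcont.tendsto 1).mono_left nhdsWithin_le_nhds
  have hev : ∀ᶠ x in 𝓝[<] (1 : ℝ), 0 ≤ φ x := by
    filter_upwards [Ioo_mem_nhdsLT (show (1 / 2 : ℝ) < 1 by norm_num)] with x hx
    exact h x hx.1 hx.2
  have h1 : 0 ≤ φ 1 := ge_of_tendsto ht hev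
  have hφ1 : φ 1 = E0 + b2 := by
    unfold φ
    ring
  linarith

/-- `∏_i p[e↦σ]_i = σ · ∏_{i ≠ e} p_i`. [folklore] -/
theorem prod_coe_update (p : ι → unitInterval) (e : ι) (σ : unitInterval) :
    ∏ i, ((update p e σ i : unitInterval) : ℝ) = (σ : ℝ) * ∏ i ∈ Finset.univ.erase e, (p i : ℝ) := by
  rw [← Finset.mul_prod_erase Finset.univ (fun i => ((update p e σ i : unitInterval) : ℝ)) (Finset.mem_univ e), update_self]
  congr 1
  exact Finset.prod_congr rfl fun i hi => by rw [update_of_ne (Finset.ne_of_mem_erase hi)]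

/-- **(MT-3) ⟹ (T3) at every coordinate** for strictly positive parameters: `0 ≤ coordPiece₂(e) + E_3(U^{e←0})`. [this work] -/
theorem twoThirdsAt_of_masterAntitone_three (hM : MasterAntitone 3) (p : ι → unitInterval) (hp : ∀ i, 0 < (p i : ℝ)) (e : ι)
    {A B C : Set (Set ι)} (hA : IsUpperSet A) (hB : IsUpperSet B) (hC : IsUpperSet C) :
    0 ≤ coordPiece₂ p e ![A, B, C] +
      sahiE (bernoulliWeight p) 3 ![ind (secAt e false A), ind (secAt e false B), ind (secAt e false C)] := by
  rw [← ind_secAt_vec3]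
  have hU : ∀ j, IsUpperSet ((![A, B, C] : Fin 3 → Set (Set ι)) j) := by
    intro j
    fin_cases j
    · exact hA
    · exact hB
    · exact hC
  -- the decomposition at a general value of `p_e`, with all pieces written at `p`
  have hdec : ∀ σ : unitInterval,
      sahiE (bernoulliWeight (update p e σ)) 3 ![ind A, ind B, ind C] =
        (1 - (σ : ℝ)) * sahiE (bernoulliWeight p) 3 (fun j => ind (secAt e false ((![A, B, C] : Fin 3 → Set (Set ι)) j)))
        + (σ : ℝ) * sahiE (bernoulliWeight p) 3 (fun j => ind (secAt e true ((![A, B, C] : Fin 3 → Set (Set ι)) j)))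
        + (σ : ℝ) * (1 - (σ : ℝ)) * ((1 - (σ : ℝ)) * coordPiece₁ p e ![A, B, C] + (σ : ℝ) * coordPiece₂ p e ![A, B, C]) := by
    intro σ
    have h := sahiE_three_decomp_coord (update p e σ) e ![A, B, C]
    rw [Pointwise.ind_vec3, update_self, SahiCoordinateChord.coordPiece₁_update_same,
      SahiCoordinateChord.coordPiece₂_update_same] at h
    have h0 := sahiE_three_secAt_update p e false σ (p e) ![A, B, C]
    have h1 := sahiE_three_secAt_update p e true σ (p e) ![A, B, C]
    rw [update_eq_self] at h0 h1
    rw [h0, h1] at h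
    exact h
  -- abbreviations
  set E0 := sahiE (bernoulliWeight p) 3 (fun j => ind (secAt e false ((![A, B, C] : Fin 3 → Set (Set ι)) j))) with hE0
  set E1 := sahiE (bernoulliWeight p) 3 (fun j => ind (secAt e true ((![A, B, C] : Fin 3 → Set (Set ι)) j))) with hE1
  set b1 := coordPiece₁ p e ![A, B, C] with hb1
  set b2 := coordPiece₂ p e ![A, B, C] with hb2
  -- the product of the other parameters is positive
  have hprod : 0 < ∏ i ∈ Finset.univ.erase e, (p i : ℝ) := Finset.prod_pos fun i _ => hp i
  -- the antitone hypothesis between `p[e↦x]` and `p[e↦1]`, with the common positive factor cancelled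
  have key : ∀ x : unitInterval, (x : ℝ) * E1 ≤ (1 - (x : ℝ)) * E0 + (x : ℝ) * E1
      + (x : ℝ) * (1 - (x : ℝ)) * ((1 - (x : ℝ)) * b1 + (x : ℝ) * b2) := by
    intro x
    have hle : ∀ i, update p e x i ≤ update p e 1 i := by
      intro i
      by_cases hi : i = e
      · subst hi
        rw [update_self, update_self]
        exact unitInterval.le_one x
      · rw [update_of_ne hi, update_of_ne hi]
    have hm := hM ι (update p e x) (update p e 1) ![A, B, C] hU hle
    rw [Pointwise.ind_vec3, hdec x, hdec 1, prod_coe_update, prod_coe_update] at hm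
    simp only [Set.Icc.coe_one, sub_self, zero_mul, one_mul, mul_zero, add_zero, zero_add] at hm
    have hm' : ((x : ℝ) * E1) * ∏ i ∈ Finset.univ.erase e, (p i : ℝ) ≤
        ((1 - (x : ℝ)) * E0 + (x : ℝ) * E1 + (x : ℝ) * (1 - (x : ℝ)) * ((1 - (x : ℝ)) * b1 + (x : ℝ) * b2))
          * ∏ i ∈ Finset.univ.erase e, (p i : ℝ) := by
      nlinarith [hm]
    exact le_of_mul_le_mul_right hm' hprod
  -- the polynomial inequality on (1/2, 1), then the limit x → 1⁻
  have hpoly : ∀ x : ℝ, 1 / 2 < x → x < 1 → 0 ≤ E0 + x * (1 - x) * b1 + x ^ 2 * b2 := by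
    intro x hx0 hx1
    have hxI : (x : ℝ) ∈ Set.Icc (0 : ℝ) 1 := ⟨by linarith, hx1.le⟩
    have k := key ⟨x, hxI⟩
    have h1x : 0 < 1 - x := by linarith
    by_contra hneg
    push Not at hneg
    nlinarith [mul_pos h1x (neg_pos.mpr hneg), k]
  have hfin := nonneg_at_one_of_nonneg_left hpoly
  linarith

end SahiCoordinateAntitone

end Summit.CriticalPhenomena.PercolationContinuityZ3.Theorems
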